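import Literature.AnabelianGeometry.EtaleTheta.Discharge.Sec3Thm37OfRankOnePointR
import Literature.AnabelianGeometry.EtaleTheta.Discharge.Sec3Prop34ConstTateTower
import HarnessLib

/-!
# [EtTh] Theorem 3.7 (i)–(iv), monoid type `Λ = ℝ`, at the MODEL OF RECORD (the Tate tower): residual = the `Λ = ℝ`
# effective-locus clause `hE` ONLY (the `B₀`-level naturality structure `Prop34Cnst₀` PROVED at the tower)

S. Mochizuki, *The étale theta function and its Frobenioid-theoretic manifestations*, Publ. RIMS **45** (2009), Thm. 3.7
(i)–(iv) PDF pp. 79–80, Prop. 3.4 (ii) p. 74, Def. 3.6 (i)/(ii) pp. 76–77 [cite: MochizukiEtTh2009, Thm 3.7 p.79].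

abc-iut cell, layer L2, node `EtTh:Thm3.7`, seat abc-iut-L2-d2 (gen 5).  PROOF-ONLY (0 definitions).  abc-iut-w6-d061's `Λ = ℝ` END KNIT
`TemperedFrobenioid.thm37_ofRankOnePointR_of_inputs` (p448135) at abc-iut-w6-d048's `TateTowerFrd.temperedFrobenioidR` (p447026) has residual
{`h₀ : Prop34Cnst₀ cnst`, `hE`, `hcyc`}.  HERE: `hcyc` := abc-iut-w6-d052's `LogDivisorModel.TateTower.prop34Const_ofGaloisActionConnected.hcyc`
(p448109), and **`TateTowerFrd.prop34Cnst₀_dm` — abc-iut-L2-t3's `B₀`-level Prop. 3.4 (ii) naturality structure `Prop34Cnst₀` HOLDS at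
the Tate tower's connected Def. 3.3 (iii) data for every CONSTANT constant-field functor** (constants `ϖ^c = (c, 0)` are shear-fixed,
so a constant function on a connected `ℤ`-set is literally constant — abc-iut-w6-d052's `exists_forall_eq_of_mem_fZero` — and so is
its log-divisor `c·Σ_j [F_j]`; hence pull-backs along any two covering maps agree; the unit kernel clause is vacuous for a constant
functor).  RESULT: **`TateTowerFrd.thm37_temperedFrobenioidR (hE)` — [EtTh] Thm. 3.7 (i) ∧ (ii) ∧ (iii) (first clause, `D^cnst := 𝓑(1)⁰`)
∧ (iv), `Λ = ℝ`, at the model of record modulo the tower's `hE` ALONE** (census A2, GAP G-w5d130-1 — the SAME single binder as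
this seat's `TateTowerFrd.cor38_i_ii_temperedFrobenioidR`, p450744).

HONEST LABEL: instantiation certificate at the one-point base `G/G` of the tower (the `p`-adic Frobenioid of the base field of the
Tate curve); `hE` at the free orbit `Y = ℤ` is genuine content (effective real combinations of `div(ϖ)`, `div(U)`), not proved here;
refereed pre-IUT material; nothing here bears on [IUTchIII] Cor. 3.12; no side taken; typed ≠ proved.
-/

noncomputable section

namespace Literature.AnabelianGeometry.EtaleTheta

open CategoryTheory Opposite Function Literature.AlgebraicGeometry.Frobenioids
  Literature.AnabelianGeometry.SemiGraphs LogDivisorModel LogDivisorModel.GaloisAction LogDivisorModel.TateTower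

namespace TateTowerFrd

/-- **`Prop34Cnst₀` at the Tate tower for every CONSTANT constant-field functor**: (1) a constant `b ∈ F₀(Y′)` takes ONE value
`(c, 0)` on the connected `ℤ`-set `Y′` (abc-iut-w6-d052's `exists_forall_eq_of_mem_fZero`), so its pull-backs along any two covering
maps `Y ⟶ Y′` coincide; (2) likewise for its log-divisor `c·Σ_j [F_j]` (`divAt_eq_constDIV`, abc-iut-w6-d058's `divZeroHom_eq_div_iff`);
(3) a constant functor identifies all automorphisms. [cite: MochizukiEtTh2009, Prop 3.4 (ii) p.74] -/
theorem prop34Cnst₀_dm {Dc : Type*} [Category Dc] (X₀ : Dc) : dm.Prop34Cnst₀ ((Functor.const D₀).obj X₀) where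
  B₀_map_eq_of_cnst_map_eq {Y Y'} g g' _ b hb := by
    obtain ⟨c, hc⟩ := exists_forall_eq_of_mem_fZero Y'.obj Y'.property.2 Y'.property.1.some b hb
    refine Subtype.ext (funext fun s => ?_)
    change b.1 (g.hom.hom s) = b.1 (g'.hom.hom s)
    rw [hc, hc]
  Φ₀_map_eq_of_cnst_map_eq {Y Y'} g g' _ x hx := by
    obtain ⟨b, hb, hbx⟩ := hx
    obtain ⟨c, hc⟩ := exists_forall_eq_of_mem_fZero Y'.obj Y'.property.2 Y'.property.1.some b hb
    have hdiv : ∀ s, x.1 s = (constDIV c : TateTower.model.DIV) := fun s => by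
      have h := (TateTower.action.divZeroHom_eq_div_iff Y'.obj b x 1).1 (by rw [map_one, div_one]; exact hbx) s
      rw [← h, divAt_eq_constDIV Y'.obj b s c (hc s)]
      exact mul_one _
    refine Subtype.ext (funext fun s => ?_)
    change x.1 (g.hom.hom s) = x.1 (g'.hom.hom s)
    rw [hdiv, hdiv]
  cnst_map_eq_of_B₀_map_eq _ _ _ := rfl

variable (R S : ((Discrete PUnit.{1})ᵒᵖ ⥤ CommMonCat.{0}) → Prop)

/-- **[EtTh] Theorem 3.7 (i)–(iv), `Λ = ℝ`, at the MODEL OF RECORD `TateTowerFrd.temperedFrobenioidR R S` modulo the tower's `hE` ONLY**: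
abc-iut-w6-d061's `thm37_ofRankOnePointR_of_inputs` with `h₀ := prop34Cnst₀_dm` (constant `cnst` at `1/1 ∈ 𝓑(1)⁰`) and `hcyc :=`
abc-iut-w6-d052's `prop34Const_ofGaloisActionConnected.hcyc`. [cite: MochizukiEtTh2009, Thm 3.7 p.79] -/
theorem thm37_temperedFrobenioidR
    (hE : ∀ (Y : (isConnectedGSet (G := Multiplicative ℤ)).FullSubcategory)
      (b : Algebra.GrothendieckGroup ((RealifiedDivisorMonoids.realDataWeak dm hpf).rlf.obj (op Y)))
      (x : (hpf (op Y)).weak.Rlf),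
      b ∈ ((RealifiedDivisorMonoids.realDataWeak dm hpf).realSpan dm.biratGp).carrier Y →
      b = Algebra.GrothendieckGroup.of x →
      b ∈ ((RealifiedDivisorMonoids.realDataWeak dm hpf).realSpan dm.cnstGp).carrier Y) :
    (PreFrobenioid.IsOfType (PreFrobenioid.IsUnitTrivial (temperedFrobenioidR R S).toElem) ∧
      PreFrobenioid.IsOfIsotropicType (temperedFrobenioidR R S).toElem ∧
      PreFrobenioid.IsOfModelType (temperedFrobenioidR R S).toElem
        ((temperedFrobenioidR R S).isFrobenioid_treeCatVocab_of_isMonoidOn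
          (TemperedFrobenioid.isMonoidOn_ratFnFunctor_ofRankOnePointR TateTower.cuspLaws rankOnePoint hpf
            R S))
        (PreFrobenioid.hasBiratSquares_of_isFrobenioid
          ((temperedFrobenioidR R S).isFrobenioid_treeCatVocab_of_isMonoidOn
            (TemperedFrobenioid.isMonoidOn_ratFnFunctor_ofRankOnePointR TateTower.cuspLaws rankOnePoint hpf
              R S))) ∧
      PreFrobenioidData.IsOfBiratFrobeniusNormalizedType
        (PreFrobenioid.biratData
          ((temperedFrobenioidR R S).isFrobenioid_treeCatVocab_of_isMonoidOn
            (TemperedFrobenioid.isMonoidOn_ratFnFunctor_ofRankOnePointR TateTower.cuspLaws rankOnePoint hpf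
              R S))
          (PreFrobenioid.hasBiratSquares_of_isFrobenioid
            ((temperedFrobenioidR R S).isFrobenioid_treeCatVocab_of_isMonoidOn
              (TemperedFrobenioid.isMonoidOn_ratFnFunctor_ofRankOnePointR TateTower.cuspLaws rankOnePoint hpf
                R S)))) ∧
      PreFrobenioid.IsOfType (PreFrobenioid.IsSubQuasiFrobeniusTrivial (temperedFrobenioidR R S).toElem) ∧
      ¬ PreFrobenioid.IsOfType (PreFrobenioid.IsGroupLikeObj (temperedFrobenioidR R S).toElem)) ∧
    ((ModelFrobenioid.data (temperedFrobenioidR R S).divisorMonoid (temperedFrobenioidR R S).ratFnFunctor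
        (temperedFrobenioidR R S).divBNatTrans).IsOfStandardType ∧
      (PreFrobenioidData.ofFunctor (temperedFrobenioidR R S).divisorMonoid
          (temperedFrobenioidR R S).toElem).IsOfRationallyStandardType
        (PreFrobenioid.rsParams
          ((temperedFrobenioidR R S).isFrobenioid_treeCatVocab_of_isMonoidOn
            (TemperedFrobenioid.isMonoidOn_ratFnFunctor_ofRankOnePointR TateTower.cuspLaws rankOnePoint hpf
              R S))
          fun a 𝔭 => PrimarySupp a 𝔭)) ∧
    (∀ X : (temperedFrobenioidR R S).category,
      FrobenioidFacade.AutActionFactorsThrough ((temperedFrobenioidR R S).base ⋙ (Functor.const D₀).obj (CosetCat.top : CosetCat PUnit.{1})) (temperedFrobenioidR R S).toElem X) ∧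
    (temperedFrobenioidR R S).Thm37_iv :=
  TemperedFrobenioid.thm37_ofRankOnePointR_of_inputs TateTower.cuspLaws rankOnePoint hpf R S
    ((Functor.const D₀).obj (CosetCat.top : CosetCat PUnit.{1})) (prop34Cnst₀_dm _) hE
    LogDivisorModel.TateTower.prop34Const_ofGaloisActionConnected.hcyc

end TateTowerFrd

end Literature.AnabelianGeometry.EtaleTheta

end
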